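import Summits.QuantumFields.BalabanUV.Beta.GAN24.BornLambdaContactPairLineage
import Summits.QuantumFields.BalabanUV.Beta.GAN24.BornLambdaContactBound
import Summits.QuantumFields.BalabanUV.Beta.GAN24.BornLambdaBracketPair

/-!
# `GAN24.BornLambdaContactDrift` — CT-ROUTE, the born-Λ RATE half («(C4)-DIFF», leaf-01 g61's `BORN-CONTACT-DIFF-PLAN-v0.md`, module D3b = THE END; `d = 3`):
# **THE CONTACT PAIR LETTER `hPc` OF leaf-06 g41's `BornLambdaDriftAssembly.exists_hBdevLam_three_of_contactPairs`** — for `2 ≤ Lc`, every weight base at the pin `|cE| ≤ Lc^4`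
# and every `cΛ` there are `CPc ≥ 0`, `0 ≤ Θc < 1` with, for EVERY in-block root and EVERY pair of consecutive Λ lineages `(i+1, k+1) ∕ (i, k)`, `1 ≤ i < k`,
# `SupBound ((W•(C_{i+1,k+1})) − (W•(C_{i,k}))) (CPc·(k−i)^1·Θc^k)`, `W = (cE·Lc^8)^{k−i}`, `C_{i,k} = push₃ T_i T_i T_i S_i − push₃ B_i B_i B_i S_i`.

NOT IN PRINT; OUR PROOF (G-an2-4 formalisation swarm, leaf prover `b2b-balaban-gan24-formalise-leaf-01`, gen 61; INTENT «(C4)-DIFF» journal `CLAIMS.log` l.35799; the END is the `hPc`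
binder of the socket holder leaf-06 g41 (W-leaf06-g41-1 l.35804) VERBATIM with `q = 1`).  HONEST FRAMING (cell contract, verbatim): «discharging `BetaPertH` makes Bałaban's UV stability
UNCONDITIONAL — a real constructive-QFT result; it is NOT the continuum limit and NOT the Clay problem.»  HONEST DEPENDENCY (verbatim): «continuum YM on T⁴ ⇐ BetaPertH ∧ nine spine
estimates (0/9 proved); BetaPertH ⇐ (D1) ∧ (D4) ∧ CAP+tail; G-an2-4 gates asym, D1 and NE2/3/4.»
ABSOLUTE RULE (cell charter, verbatim): «No internally-minted statement may enter as a cited fact. Every hypothesis is either kernel-proved in this package or a verbatim quotation of a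
PUBLISHED theorem with page reference. The manuscript(s) under audit are NOT citable for their own disputed steps — they are the thing under adjudication; programme-internal
(2001/route/tribunal) claims are never citable.»

## What is proved (`d = 3`, `2 ≤ Lc`)
The two members `(i+1, k+1)` and `(i, k)` have the SAME chain length `n = k−1−i` and live on ONE lattice (relative coordinates); they differ through the birth level only, and every
slot's difference is a TREE letter at rate `θ^{i+n}`: the undressed legs by the owner's CT-4a `RespStepCauchy.exists_respStep_cauchy`, the gauge staircase pieces by gan24-p2 g34's
`ContactGaugeStaircaseCauchyPack.gauge_succ_sub_eq_staircase ∕ abs_gaugePieceSucc_le`, the brackets by leaf-01 g61's D1 `BornLambdaBracketPair.exists_bracket_bornLam_succ_pair_letter_three`;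
the undifferenced slots carry leaf-02 g49's (C4) PART 4∕5 letters ((N1), `exists_legChain_envelope`, `exists_abs_lineageGauge_le`, the born coefficients' decay∕transversality,
p2 g33's bracket letter).  D2c `BornLambdaContactPairEntry.abs_contactPair_entry_le` bounds the pair entry with ONE Δ-letter in every term; PART 4's `units_le` counts the powers.
* §1 `final_le`, `bracketPair_letter_mono` (two scalar steps).
* §2 **`exists_hPc_three`** — the title statement (`Θc = max(Lc⁻¹, ϑ)`, `ϑ = max(θ_CT-4a, θ_D1)`), over D3a `BornLambdaContactPairLineage.abs_weight_mul_contactPair_le_three` (the weighted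
  pair entry with every letter a hypothesis) with every letter DISCHARGED from the tree.
[folklore] bookkeeping over the files named above BY NAME; 0 `def`, 0 cited facts, 0 `def … : Prop`, 0 sorry, 0 wall binders; NO estimate of Bałaban's beyond what those files carry.
WHAT THIS DISCHARGES AND WHAT NOT: the binder `hPc` of leaf-06 g41's `exists_hBdevLam_three_of_contactPairs` (the CONTACT pairs `i ≥ 1` of the born-Λ all-scales Cauchy letter); NOT the
undressed pairs (leaf-06's `exists_pairU_sup_three`), NOT the pair `i = 0` (leaf-06's `exists_pairZero_lam_three`), NOT hSdev, NOT (CONV-C); NEVER «G-an2-4 closed»; NOT D1, NOT BetaPertH,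
NOT continuum, NOT Clay.
-/

noncomputable section

open Finset
open scoped BigOperators
open Literature.MathematicalPhysics.QuantumFieldTheory
open Literature.MathematicalPhysics.QuantumFieldTheory.LatticeForm (quo)
open Literature.MathematicalPhysics.QuantumFieldTheory.Balaban1983to89
open Literature.MathematicalPhysics.QuantumFieldTheory.Balaban1983to89.Beta
open B4ContourShift (supNorm supNorm_nonneg)
open B12Sec2to5 (l1 l1_nonneg)
open ExpKernelCalculus (MKer Zl Zl_nonneg)
open AffineAveraging (Form0 Form1 Site box toSite unitVec dz)
open AveragingContours (blk)
open AveragingHessianKernels (ell)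
open AveragingHessianKernelsRooted (hessFFAt)
open OneStepResolventKernel (Fib)
open InterLevelTransport (SLam)
open KernelWard (divV)
open KKTFluctuationKernel (delta1)
open BalabanCompositeJets (respStep)
open Summit.QuantumFields.BalabanUV.Beta.AxialProjectorBlockMean (bmGaugeAt)
open Summit.QuantumFields.BalabanUV.Beta.GAN24.RespStepBmDecompPsi (Psi)
open Summit.QuantumFields.BalabanUV.Beta.GAN24.RespStepBmDecompExact (respStepBmSeq)
open Summit.QuantumFields.BalabanUV.Beta.GAN24.Push4Iter (legChain)
open Summit.QuantumFields.BalabanUV.Beta.GAN24.Push3 (push₃ isFF_push₃)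
open Summit.QuantumFields.BalabanUV.Beta.GAN24.Push3LegTelescope (abs_le_of_env' summable_of_env')
open OneStepResolventKernel (KInv)
open BalabanStepJetsSucc (E2 lamCoeffK)
open Summit.QuantumFields.BalabanUV.Beta.HessKerDressedUnits (unitS)
open Summit.QuantumFields.BalabanUV.Beta.GAN24.CombesThomas (SupBound sfStep smStep KStepUnit)
open Summit.QuantumFields.BalabanUV.Beta.GAN24.SrecBornSector (freshAt)
open Summit.QuantumFields.BalabanUV.Beta.GAN24.ContactLambdaCellBound (exp_env_mono_rate)
open Summit.QuantumFields.BalabanUV.Beta.GAN24.BornLambdaContactCells (unitS_freshAt_lam_succ_eq_SLam divV_bornLam_succ_eq_zero abs_bornLamCoeff_succ_le_of_unitDecayK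
  exists_abs_lineageGauge_le)
open Summit.QuantumFields.BalabanUV.Beta.GAN24.BornLambdaBracketLetter (exists_bracket_bornLam_succ_letter_three)
open Summit.QuantumFields.BalabanUV.Beta.GAN24.BornLambdaBracketPair (exists_bracket_bornLam_succ_pair_letter_three)
open Summit.QuantumFields.BalabanUV.Beta.GAN24.RespStepDecay (exists_respStep_decay_and_grad)
open Summit.QuantumFields.BalabanUV.Beta.GAN24.RespStepCauchy (exists_respStep_cauchy)
open Summit.QuantumFields.BalabanUV.Beta.GAN24.DressedLegEnvelope (exists_legChain_envelope)
open Summit.QuantumFields.BalabanUV.Beta.GAN24.UndressedResponseUnits (inv_cast_pow_pow)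
open Summit.QuantumFields.BalabanUV.Beta.GAN24.FibreStrip (unitDecayK_holds)

open Summit.QuantumFields.BalabanUV.Beta.GAN24.BornLambdaContactPairLineage (abs_weight_mul_contactPair_le_three)

namespace Summit.QuantumFields.BalabanUV.Beta.GAN24.BornLambdaContactDrift

variable {Lc : ℕ} [NeZero Lc]

/-! ## §1 Two scalar steps -/

omit [NeZero Lc] in
/-- [folklore] the last step of §3: `B·(N·r)·p·E ≤ B·(N·Θ)` once `E ≤ 1` and `r·p ≤ Θ` (all letters nonnegative). -/
theorem final_le {B N r p E Θ : ℝ} (hB : 0 ≤ B) (hN : 0 ≤ N) (hr : 0 ≤ r) (hp : 0 ≤ p) (hE : E ≤ 1) (hrp : r * p ≤ Θ) :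
    B * (N * r) * p * E ≤ B * (N * Θ) := by
  have h0 : 0 ≤ B * (N * r) * p := by positivity
  calc B * (N * r) * p * E ≤ B * (N * r) * p * 1 := mul_le_mul_of_nonneg_left hE h0
    _ = B * N * (r * p) := by ring
    _ ≤ B * N * Θ := mul_le_mul_of_nonneg_left hrp (by positivity)
    _ = B * (N * Θ) := by ring

omit [NeZero Lc] in
/-- [folklore] weakening a bracket PAIR letter `|X| ≤ |cΛ|·C·θ^p·q·e^{−δ s}` in constant and rate. -/
theorem bracketPair_letter_mono {X cΛ C C' δ δ' θp qi s : ℝ} (hC : C ≤ C') (hδ : δ' ≤ δ) (hθp : 0 ≤ θp) (hqi : 0 ≤ qi) (hs : 0 ≤ s)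
    (h : |X| ≤ |cΛ| * C * θp * qi * Real.exp (-(δ * s))) : |X| ≤ |cΛ| * C' * θp * qi * Real.exp (-(δ' * s)) := by
  have hA : 0 ≤ |cΛ| * C * θp * qi := by
    by_contra hlt
    rw [not_le] at hlt
    have h1 : |cΛ| * C * θp * qi * Real.exp (-(δ * s)) < 0 := mul_neg_of_neg_of_pos hlt (Real.exp_pos _)
    linarith [abs_nonneg X, h.trans_lt h1]
  refine h.trans ?_
  calc |cΛ| * C * θp * qi * Real.exp (-(δ * s)) ≤ |cΛ| * C * θp * qi * Real.exp (-(δ' * s)) :=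
        mul_le_mul_of_nonneg_left (exp_env_mono_rate hδ hs) hA
    _ ≤ |cΛ| * C' * θp * qi * Real.exp (-(δ' * s)) := by
        have : |cΛ| * C * θp * qi ≤ |cΛ| * C' * θp * qi :=
          mul_le_mul_of_nonneg_right (mul_le_mul_of_nonneg_right (mul_le_mul_of_nonneg_left hC (abs_nonneg _)) hθp) hqi
        exact mul_le_mul_of_nonneg_right this (Real.exp_pos _).le

/-! ## §2 The END: leaf-06 g41's `hPc` -/

/-- NOT IN PRINT; OUR PROOF.  **THE CONTACT PAIR LETTER `hPc` OF THE BORN-Λ RATE HALF** (`d = 3`, `2 ≤ Lc`, any weight base at the pin `|cE| ≤ Lc^4`, any `cΛ`): there are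
`CPc ≥ 0` and `0 ≤ Θc < 1` such that for EVERY in-block root and all `1 ≤ i < k`, the weighted contact entries of the consecutive Λ lineages `(i+1, k+1)` and `(i, k)` differ by at
most `CPc·(k−i)^1·Θc^k` in `SupBound` — LITERALLY the binder `hPc` (with `q = 1`) of leaf-06 g41's `BornLambdaDriftAssembly.exists_hBdevLam_three_of_contactPairs`.  §2 with every
letter DISCHARGED from the tree: (N1) `exists_respStep_decay_and_grad`, CT-4a `exists_respStep_cauchy` (one rate by `min`), `exists_legChain_envelope`, `exists_abs_lineageGauge_le`,
`unitDecayK_holds` + `abs_bornLamCoeff_succ_le_of_unitDecayK` + `divV_bornLam_succ_eq_zero` for both members' coefficients (`i = j+1`, `i+1 = j+2`), p2 g33's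
`exists_bracket_bornLam_succ_letter_three` (both brackets) and D1's `exists_bracket_bornLam_succ_pair_letter_three` (their difference); `Θc = max(Lc⁻¹, θ)`. -/
theorem exists_hPc_three (hLc : 2 ≤ Lc) {cE : ℝ} (hcE : |cE| ≤ (Lc : ℝ) ^ 4) (cΛ : ℝ) :
    ∃ CPc Θc : ℝ, 0 ≤ CPc ∧ 0 ≤ Θc ∧ Θc < 1 ∧ ∀ (rr : Fin (3 + 1) → ℕ), rr ∈ box (3 + 1) Lc → ∀ k i : ℕ, 1 ≤ i → i < k → ∀ κ u,
      SupBound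
        (((fun κ' u' => (cE * (Lc : ℝ) ^ (2 * (3 + 1))) ^ (k - i) •
            (push₃ (legChain (respStepBmSeq (toSite rr) Lc) (i + 1) (k - 1 - i)) (legChain (respStepBmSeq (toSite rr) Lc) (i + 1) (k - 1 - i))
                (legChain (respStepBmSeq (toSite rr) Lc) (i + 1) (k - 1 - i))
                (unitS (sfStep Lc (i + 1)) (smStep 3 Lc (i + 1)) (freshAt Lc (toSite rr) 0 cΛ (i + 1))) κ' u'
              - push₃ (respStep (d := 3) (Lc ^ (i + 1)) (Lc ^ (k + 1))) (respStep (d := 3) (Lc ^ (i + 1)) (Lc ^ (k + 1)))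
                (respStep (d := 3) (Lc ^ (i + 1)) (Lc ^ (k + 1)))
                (unitS (sfStep Lc (i + 1)) (smStep 3 Lc (i + 1)) (freshAt Lc (toSite rr) 0 cΛ (i + 1))) κ' u'))
          - fun κ' u' => (cE * (Lc : ℝ) ^ (2 * (3 + 1))) ^ (k - i) •
            (push₃ (legChain (respStepBmSeq (toSite rr) Lc) i (k - 1 - i)) (legChain (respStepBmSeq (toSite rr) Lc) i (k - 1 - i))
                (legChain (respStepBmSeq (toSite rr) Lc) i (k - 1 - i))
                (unitS (sfStep Lc i) (smStep 3 Lc i) (freshAt Lc (toSite rr) 0 cΛ i)) κ' u'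
              - push₃ (respStep (d := 3) (Lc ^ i) (Lc ^ k)) (respStep (d := 3) (Lc ^ i) (Lc ^ k)) (respStep (d := 3) (Lc ^ i) (Lc ^ k))
                (unitS (sfStep Lc i) (smStep 3 Lc i) (freshAt Lc (toSite rr) 0 cΛ i)) κ' u')) κ u)
        (CPc * ((((k - i : ℕ) : ℝ)) ^ 1 * Θc ^ k)) := by
  have hLc1 : 1 ≤ Lc := le_trans (by norm_num) hLc
  have hL : (0 : ℝ) < (Lc : ℝ) := Nat.cast_pos.2 (Nat.pos_of_ne_zero (NeZero.ne Lc))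
  -- the tree letters, constants outside every ∀
  obtain ⟨κ₀, C₁, -, hκ₀, hC₁, -, hN1raw, -⟩ := exists_respStep_decay_and_grad (Lc := Lc)
  obtain ⟨cC, θ, κc, hcC, hθ0, hθ1, hκc, hCauRaw⟩ := exists_respStep_cauchy (Lc := Lc) hLc
  set κ₁ : ℝ := min κ₀ κc with hκ₁def
  have hκ₁ : 0 < κ₁ := lt_min hκ₀ hκc
  have hN1 : ∀ (m k : ℕ) (μ : Fin (3 + 1)) (z : Site (3 + 1)) (l'' : Fin (3 + 1)) (w' : Site (3 + 1)),
      |respStep (d := 3) (Lc ^ m) (Lc ^ (m + k + 1)) μ z l'' w'| ≤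
        C₁ * ((Lc : ℝ) ^ (5 * (k + 1)))⁻¹ * Real.exp (-(κ₁ * supNorm (quo (Lc ^ (k + 1)) w' - z))) := by
    intro m k μ z l'' w'
    have h := hN1raw m k μ z l'' w'
    rw [inv_cast_pow_pow] at h
    exact h.trans (mul_le_mul_of_nonneg_left (exp_env_mono_rate (min_le_left _ _) (supNorm_nonneg _)) (by positivity))
  have hCau : ∀ (s k : ℕ) (μ : Fin (3 + 1)) (z : Site (3 + 1)) (l : Fin (3 + 1)) (w : Site (3 + 1)),
      |respStep (d := 3) (Lc ^ (s + 1)) (Lc ^ (s + k + 2)) μ z l w - respStep (d := 3) (Lc ^ s) (Lc ^ (s + k + 1)) μ z l w|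
        ≤ cC * θ ^ (s + k) * ((((Lc ^ (k + 1) : ℕ) : ℝ)) ^ (3 + 2))⁻¹ * Real.exp (-(κ₁ * supNorm (quo (Lc ^ (k + 1)) w - z))) := by
    intro s k μ z l w
    exact (hCauRaw s k μ z l w).trans (mul_le_mul_of_nonneg_left (exp_env_mono_rate (min_le_right _ _) (supNorm_nonneg _)) (by positivity))
  obtain ⟨κE, KE, hκE, -, hEnv⟩ := exists_legChain_envelope (Lc := Lc) hLc
  obtain ⟨Klam, -, hKlam⟩ := exists_abs_lineageGauge_le (Lc := Lc) hLc
  obtain ⟨Cs, δs, hCs, hδs, hbs⟩ := exists_bracket_bornLam_succ_letter_three (Lc := Lc) hLc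
  obtain ⟨CP, δP, θP, hCP, hδP, hθP0, hθP1, hbP⟩ := exists_bracket_bornLam_succ_pair_letter_three (Lc := Lc) hLc
  obtain ⟨κK, hκK, Cst, hK⟩ := unitDecayK_holds (Lc := Lc)
  -- one bracket rate, one geometric rate
  set δK : ℝ := min δs δP with hδKdef
  have hδK : 0 < δK := lt_min hδs hδP
  set ϑ : ℝ := max θ θP with hϑdef
  have hϑ0 : 0 ≤ ϑ := hθ0.trans (le_max_left _ _)
  have hϑ1 : ϑ < 1 := max_lt hθ1 hθP1
  have hCauϑ : ∀ (s k : ℕ) (μ : Fin (3 + 1)) (z : Site (3 + 1)) (l : Fin (3 + 1)) (w : Site (3 + 1)),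
      |respStep (d := 3) (Lc ^ (s + 1)) (Lc ^ (s + k + 2)) μ z l w - respStep (d := 3) (Lc ^ s) (Lc ^ (s + k + 1)) μ z l w|
        ≤ cC * ϑ ^ (s + k) * ((((Lc ^ (k + 1) : ℕ) : ℝ)) ^ (3 + 2))⁻¹ * Real.exp (-(κ₁ * supNorm (quo (Lc ^ (k + 1)) w - z))) := by
    intro s k μ z l w
    refine (hCau s k μ z l w).trans ?_
    have hp : θ ^ (s + k) ≤ ϑ ^ (s + k) := pow_le_pow_left₀ hθ0 (le_max_left _ _) _
    have h0 : 0 ≤ ((((Lc ^ (k + 1) : ℕ) : ℝ)) ^ (3 + 2))⁻¹ * Real.exp (-(κ₁ * supNorm (quo (Lc ^ (k + 1)) w - z))) := by positivity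
    calc cC * θ ^ (s + k) * ((((Lc ^ (k + 1) : ℕ) : ℝ)) ^ (3 + 2))⁻¹ * Real.exp (-(κ₁ * supNorm (quo (Lc ^ (k + 1)) w - z)))
        = (cC * θ ^ (s + k)) * (((((Lc ^ (k + 1) : ℕ) : ℝ)) ^ (3 + 2))⁻¹ * Real.exp (-(κ₁ * supNorm (quo (Lc ^ (k + 1)) w - z)))) := by ring
      _ ≤ (cC * ϑ ^ (s + k)) * (((((Lc ^ (k + 1) : ℕ) : ℝ)) ^ (3 + 2))⁻¹ * Real.exp (-(κ₁ * supNorm (quo (Lc ^ (k + 1)) w - z)))) :=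
          mul_le_mul_of_nonneg_right (mul_le_mul_of_nonneg_left hp hcC) h0
      _ = _ := by ring
  have hκ : 0 < min δK κ₁ := lt_min hδK hκ₁
  -- the coefficient letter (uniform in the member)
  have hrate : 0 < κK / ((3 + 1) * (Lc : ℝ)) := by positivity
  have hrate2 : 0 < κK / ((3 + 1) * (Lc : ℝ)) / 2 := by positivity
  have hCc : 0 ≤ |cΛ * (Lc : ℝ) ^ (2 * (3 + 1))| * ((Fintype.card (Fib 3) : ℝ) * (Cst * Real.exp (2 * κK) * (Cst * Real.exp (2 * κK)))
      * Zl (3 + 1) (κK / ((3 + 1) * (Lc : ℝ)) - κK / ((3 + 1) * (Lc : ℝ)) / 2)) := by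
    have hz : 0 ≤ Zl (3 + 1) (κK / ((3 + 1) * (Lc : ℝ)) - κK / ((3 + 1) * (Lc : ℝ)) / 2) := Zl_nonneg (by linarith)
    have hsq : 0 ≤ Cst * Real.exp (2 * κK) * (Cst * Real.exp (2 * κK)) := mul_self_nonneg _
    positivity
  have hTb : 0 ≤ |cΛ| * Cs := mul_nonneg (abs_nonneg _) hCs
  have hTΔ : 0 ≤ |cΛ| * CP := mul_nonneg (abs_nonneg _) hCP
  -- the constants
  set Θc : ℝ := max (Lc : ℝ)⁻¹ ϑ with hΘcdef
  have hΘc0 : 0 ≤ Θc := hϑ0.trans (le_max_right _ _)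
  have hΘc1 : Θc < 1 := by
    refine max_lt ?_ hϑ1
    have h2 : (2 : ℝ) ≤ Lc := by exact_mod_cast hLc
    rw [inv_lt_one_iff₀]; right; linarith
  have hZ : 0 ≤ Zl (3 + 1) (min δK κ₁ / (4 * ((3 : ℝ) + 1))) := Zl_nonneg (by positivity)
  refine ⟨(Lc : ℝ) ^ 3 * ((2 * (Lc : ℝ) ^ (3 + 1))⁻¹ * ((((3 : ℝ) + 1) * (Real.exp (2 * ((3 : ℝ) + 1) * min δK κ₁) ^ 2 *
              (((2 * Lc : ℕ) : ℝ) ^ (3 + 1) * (((3 + 1 : ℕ) : ℝ) * ((Lc : ℝ) ^ (3 + 1) * (ell (3 + 1) Lc : ℝ)))))))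
            * (C₁ * ((|cΛ| * CP) * C₁ + 2 * (|cΛ| * Cs) * cC)) * ((Lc : ℝ) * (64 + 544 * Lc + 768 * (Lc : ℝ) ^ 2)) * Zl (3 + 1) (min δK κ₁ / (4 * ((3 : ℝ) + 1)))),
    Θc, by positivity, hΘc0, hΘc1, fun rr hrr k i hi hik κ₂ u₂ x z a b => ?_⟩
  obtain ⟨n, rfl⟩ : ∃ n, k = i + n + 1 := ⟨k - i - 1, by omega⟩
  obtain ⟨j, rfl⟩ : ∃ j, i = j + 1 := ⟨i - 1, by omega⟩
  have e1 : j + 1 + n + 1 - 1 - (j + 1) = n := by omega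
  have e2 : j + 1 + n + 1 - (j + 1) = n + 1 := by omega
  have e3 : j + 1 + n + 1 + 1 = j + 1 + 1 + n + 1 := by omega
  -- the two members' letters with explicit constants
  have hE : ∀ m μ z' l u, |legChain (respStepBmSeq (d := 3) (toSite rr) Lc) m n μ z' l u|
      ≤ (KE * ((Lc : ℝ) ^ (4 * (n + 1)))⁻¹) * Real.exp (-(κE * supNorm (quo (Lc ^ (n + 1)) u - z'))) :=
    fun m μ z' l u => hEnv rr hrr m n μ z' l u
  have hlam : ∀ m μ z' u, |(Psi (toSite rr) Lc m n (delta1 μ z')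
      - bmGaugeAt (toSite rr) (respStep (d := 3) (Lc ^ m) (Lc ^ (m + n + 1)) μ z') Lc) u| ≤ Klam * ((Lc : ℝ) ^ (4 * (n + 1)))⁻¹ :=
    fun m μ z' u => hKlam rr hrr m n μ z' u
  have hqi : 0 ≤ ((((Lc : ℝ) ^ n) ^ (2 * 3 + 1))⁻¹) := by positivity
  have hϑp : 0 ≤ ϑ ^ (j + 1 + n) := pow_nonneg hϑ0 _
  have hbr' : ∀ (κ' : Fin (3 + 1)) (u' : Site (3 + 1)) μ y,
      |∑' u, ∑ l, legChain (respStepBmSeq (d := 3) (toSite rr) Lc) (j + 1 + 1) n κ' u' l u *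
          ((cΛ * (Lc : ℝ) ^ (2 * (3 + 1))) * lamCoeffK (KStepUnit (d := 3) Lc (j + 1 + 1)) ((smStep 3 Lc (j + 1)) ^ 2 • E2 3 Lc (j + 1 + 1)) Lc μ y l u)|
        ≤ |cΛ| * Cs * ((((Lc : ℝ) ^ n) ^ (2 * 3 + 1))⁻¹) * Real.exp (-(δK * supNorm (quo (Lc ^ n) y - u'))) := by
    intro κ' u' μ y
    have h := hbs rr hrr cΛ (j + 1) (j + 1 + 1 + n + 1) κ' u' μ y
    rw [show j + 1 + 1 + n + 1 - 1 - (j + 1 + 1) = n by omega] at h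
    exact BornLambdaContactBound.bracket_letter_mono le_rfl (min_le_left _ _) hqi (supNorm_nonneg _) h
  have hbr : ∀ (κ' : Fin (3 + 1)) (u' : Site (3 + 1)) μ y,
      |∑' u, ∑ l, legChain (respStepBmSeq (d := 3) (toSite rr) Lc) (j + 1) n κ' u' l u *
          ((cΛ * (Lc : ℝ) ^ (2 * (3 + 1))) * lamCoeffK (KStepUnit (d := 3) Lc (j + 1)) ((smStep 3 Lc j) ^ 2 • E2 3 Lc (j + 1)) Lc μ y l u)|
        ≤ |cΛ| * Cs * ((((Lc : ℝ) ^ n) ^ (2 * 3 + 1))⁻¹) * Real.exp (-(δK * supNorm (quo (Lc ^ n) y - u'))) := by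
    intro κ' u' μ y
    have h := hbs rr hrr cΛ j (j + 1 + n + 1) κ' u' μ y
    rw [show j + 1 + n + 1 - 1 - (j + 1) = n by omega] at h
    exact BornLambdaContactBound.bracket_letter_mono le_rfl (min_le_left _ _) hqi (supNorm_nonneg _) h
  have hbrΔ : ∀ (κ' : Fin (3 + 1)) (u' : Site (3 + 1)) μ y,
      |(∑' u, ∑ l, legChain (respStepBmSeq (d := 3) (toSite rr) Lc) (j + 1 + 1) n κ' u' l u *
          ((cΛ * (Lc : ℝ) ^ (2 * (3 + 1))) * lamCoeffK (KStepUnit (d := 3) Lc (j + 1 + 1)) ((smStep 3 Lc (j + 1)) ^ 2 • E2 3 Lc (j + 1 + 1)) Lc μ y l u))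
        - ∑' u, ∑ l, legChain (respStepBmSeq (d := 3) (toSite rr) Lc) (j + 1) n κ' u' l u *
          ((cΛ * (Lc : ℝ) ^ (2 * (3 + 1))) * lamCoeffK (KStepUnit (d := 3) Lc (j + 1)) ((smStep 3 Lc j) ^ 2 • E2 3 Lc (j + 1)) Lc μ y l u)|
        ≤ |cΛ| * CP * ϑ ^ (j + 1 + n) * ((((Lc : ℝ) ^ n) ^ (2 * 3 + 1))⁻¹) * Real.exp (-(δK * supNorm (quo (Lc ^ n) y - u'))) := by
    intro κ' u' μ y
    have h := hbP rr hrr cΛ j n κ' u' μ y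
    have hp : θP ^ (j + 1 + n) ≤ ϑ ^ (j + 1 + n) := pow_le_pow_left₀ hθP0 (le_max_right _ _) _
    have h' : |(∑' u, ∑ l, legChain (respStepBmSeq (d := 3) (toSite rr) Lc) (j + 1 + 1) n κ' u' l u *
          ((cΛ * (Lc : ℝ) ^ (2 * (3 + 1))) * lamCoeffK (KStepUnit (d := 3) Lc (j + 1 + 1)) ((smStep 3 Lc (j + 1)) ^ 2 • E2 3 Lc (j + 1 + 1)) Lc μ y l u))
        - ∑' u, ∑ l, legChain (respStepBmSeq (d := 3) (toSite rr) Lc) (j + 1) n κ' u' l u *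
          ((cΛ * (Lc : ℝ) ^ (2 * (3 + 1))) * lamCoeffK (KStepUnit (d := 3) Lc (j + 1)) ((smStep 3 Lc j) ^ 2 • E2 3 Lc (j + 1)) Lc μ y l u)|
        ≤ |cΛ| * CP * ϑ ^ (j + 1 + n) * ((((Lc : ℝ) ^ n) ^ (2 * 3 + 1))⁻¹) * Real.exp (-(δP * supNorm (quo (Lc ^ n) y - u'))) := by
      refine h.trans ?_
      have h0 : 0 ≤ ((((Lc : ℝ) ^ n) ^ (2 * 3 + 1))⁻¹) * Real.exp (-(δP * supNorm (quo (Lc ^ n) y - u'))) := by positivity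
      calc |cΛ| * CP * θP ^ (j + 1 + n) * ((((Lc : ℝ) ^ n) ^ (2 * 3 + 1))⁻¹) * Real.exp (-(δP * supNorm (quo (Lc ^ n) y - u')))
          = (|cΛ| * CP * θP ^ (j + 1 + n)) * (((((Lc : ℝ) ^ n) ^ (2 * 3 + 1))⁻¹) * Real.exp (-(δP * supNorm (quo (Lc ^ n) y - u')))) := by ring
        _ ≤ (|cΛ| * CP * ϑ ^ (j + 1 + n)) * (((((Lc : ℝ) ^ n) ^ (2 * 3 + 1))⁻¹) * Real.exp (-(δP * supNorm (quo (Lc ^ n) y - u')))) :=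
            mul_le_mul_of_nonneg_right (mul_le_mul_of_nonneg_left hp hTΔ) h0
        _ = _ := by ring
    exact bracketPair_letter_mono le_rfl (min_le_right _ _) hϑp hqi (supNorm_nonneg _) h'
  -- `(Lc⁻¹)^{n+1}·ϑ^{j+1+n}·EX ≤ Θc^{j+1+n+1}`
  have hEX : Real.exp (-(min δK κ₁ / 12) * (supNorm (x - u₂) + supNorm (z - u₂))) ≤ 1 := by
    rw [Real.exp_le_one_iff]
    have : 0 ≤ supNorm (x - u₂) + supNorm (z - u₂) := add_nonneg (supNorm_nonneg _) (supNorm_nonneg _)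
    have hk : 0 ≤ min δK κ₁ / 12 := by positivity
    nlinarith
  have hpow : ((Lc : ℝ)⁻¹) ^ (n + 1) * ϑ ^ (j + 1 + n) ≤ Θc ^ (j + 1 + n + 1) := by
    have h1 : ((Lc : ℝ)⁻¹) ^ (n + 1) ≤ Θc ^ (n + 1) := pow_le_pow_left₀ (inv_pos.2 hL).le (le_max_left _ _) _
    have h2 : ϑ ^ (j + 1 + n) ≤ Θc ^ (j + 1 + n) := pow_le_pow_left₀ hϑ0 (le_max_right _ _) _
    have h3 : Θc ^ (n + 1) * Θc ^ (j + 1 + n) ≤ Θc ^ (j + 1 + n + 1) := by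
      rw [← pow_add]
      exact pow_le_pow_of_le_one hΘc0 hΘc1.le (by omega)
    exact (mul_le_mul h1 h2 hϑp (pow_nonneg hΘc0 _)).trans h3
  have hBIG : 0 ≤ (Lc : ℝ) ^ 3 * ((2 * (Lc : ℝ) ^ (3 + 1))⁻¹ * ((((3 : ℝ) + 1) * (Real.exp (2 * ((3 : ℝ) + 1) * min δK κ₁) ^ 2 *
              (((2 * Lc : ℕ) : ℝ) ^ (3 + 1) * (((3 + 1 : ℕ) : ℝ) * ((Lc : ℝ) ^ (3 + 1) * (ell (3 + 1) Lc : ℝ)))))))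
            * (C₁ * ((|cΛ| * CP) * C₁ + 2 * (|cΛ| * Cs) * cC)) * ((Lc : ℝ) * (64 + 544 * Lc + 768 * (Lc : ℝ) ^ 2)) * Zl (3 + 1) (min δK κ₁ / (4 * ((3 : ℝ) + 1)))) := by
    positivity
  have hn0 : 0 ≤ (n : ℝ) + 1 := by positivity
  -- §2 at the two members' coefficient families, then the last step
  have key := fun (a' b' : Fib 3) =>
    (abs_weight_mul_contactPair_le_three (i := j + 1) (n := n) hLc hrr hcE hN1 hCauϑ hκ₁ hC₁ hcC hϑ0 hE hκE hlam
      (abs_bornLamCoeff_succ_le_of_unitDecayK (d := 3) hK hrate cΛ (j + 1)) hrate2 hCc (divV_bornLam_succ_eq_zero hrr cΛ (j + 1))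
      (abs_bornLamCoeff_succ_le_of_unitDecayK (d := 3) hK hrate cΛ j) hrate2 hCc (divV_bornLam_succ_eq_zero hrr cΛ j)
      hbr' hbr hbrΔ hδK hTb hTΔ κ₂ u₂ x z a' b').trans
    (final_le hBIG hn0 (pow_nonneg (inv_pos.2 hL).le _) hϑp hEX hpow)
  rw [e3]
  simpa only [e1, e2, Pi.sub_apply, Pi.smul_apply, smul_eq_mul, pow_one, Nat.cast_succ, unitS_freshAt_lam_succ_eq_SLam] using key a b

end Summit.QuantumFields.BalabanUV.Beta.GAN24.BornLambdaContactDrift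

end
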